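import Literature.ComputerArithmetic.Shewchuk1997.Orient3dStageA
import Mathlib.Tactic.Linarith
import Mathlib.Tactic.Positivity
import Mathlib.Tactic.Ring
import Mathlib.Tactic.NormNum

/-!
# A floating-point filter for INSPHERE: the error analysis (lemmas)

NEW WORK of this development (ENGINES group, unit `eng-quad-4`; HONEST FRAMING: shared numerical
engines serving client cells; rigour lives in the verifiers; every published number belongs to a
client cell's ledger, not to the engines group).  Not a published result, hence under
`Summits/Ventures/` with no citation tag of its own: Shewchuk's paper analyses the stage-A filters
of ORIENT2D, ORIENT3D and INCIRCLE [Shewchuk1997, Tables 1, 3, 5] but prints NO error bound for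
INSPHERE (§4.4 gives only its timings, Table 7); the public-domain `predicates.c` nevertheless
ships an INSPHERE filter with a constant of the same shape, `(16 + 224ε)ε` to our understanding
(text not held).  This file and `InsphereFilter*.lean` supply what the paper leaves out: an error
analysis of a stage-A evaluation of the INSPHERE determinant, by the method of §4.3 p. 348 carried
two levels up, ending in a PROOF that the constant `(16 + 224ε)ε` is sound for every precision
`p ≥ 6`.

THE SHAPE OF THE ANALYSIS (all errors are bounded by a polynomial in `ε = u = 2^−p` times a
nonnegative MAJORANT built from computed quantities, so that the majorants assemble into the
permanent the filter evaluates):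
* a cofactor term `z ⊗ ((x₁ ⊗ y₂) ⊖ (y₁ ⊗ x₂))` — `cofactor_sub_le_of_rel` of the ORIENT3D file:
  error `(6ε + 7ε² + 4ε³ + ε⁴)·|z|(|P| + |P'|)`, size `(1 + ε)²·|z|(|P| + |P'|)`;
* a `3 × 3` minor `(Q₁ ⊖ Q₂) ⊕ Q₃` of three cofactor terms — `sum3_sub_le_of_rel` (generic in the
  incoming coefficients `a`, `b`): error `a + (2ε + ε²)b`, size `(1 + ε)²b`, true size `a + b`;
* a three-dimensional lift `(x ⊗ x ⊕ y ⊗ y) ⊕ z ⊗ z` — `lift3_sub_le_of_rel`: relative error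
  `(1 + ε)⁵ − 1` w.r.t. the computed lift, which is nonnegative;
* a lifted term `lift ⊗ minor` — `liftedTerm_sub_le_of_rel`: error `vc + a + εb`;
* the determinant `(q_d ⊖ q_c) ⊕ (q_b ⊖ q_a)` — `det4_sub_le_of_rel`: `ε|det| + (a + εb)·Π`;
* the permanent, evaluated in floating point on nonnegative data, is at least `(1 − ε)⁹·K·Π`
  (`perm3_lower`, `perm4_lower`);
* composing the coefficients gives the polynomial
  `15ε + 71ε² + 154ε³ + 201ε⁴ + 172ε⁵ + 99ε⁶ + 38ε⁷ + 9ε⁸ + ε⁹`; that it is at most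
  `(1 − ε)¹⁰(16 + 224ε)ε` for `0 ≤ ε ≤ 1/64`, and the passage from a passed test
  `errbound < |det|` to `sign det = sign D`, are `isperrboundA_margin` / `sign_of_err_of_test` of
  `InsphereFilter.lean` (kept there with the constant and the transcription of the filter).
The first-order constant is `15 = 5 (lift) + 4 (minor) + 1 + 1 (cofactor) + 2 (two additions)
+ 1 (product) + 1 (first of the last additions)`; the `16` of the constant leaves first-order
slack, so the margin is comfortable (`≈ 0.48ε` at `ε = 1/64`) — unlike ORIENT3D / INCIRCLE, whose
printed constants are tight at first order.

HONEST SCOPE.  Pure inequalities between rationals; the floating-point model enters only in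
`InsphereFilterCorrect.lean`.  The bounds are not claimed to be optimal.

Reference for the method: J. R. Shewchuk, Discrete Comput. Geom. 18 (1997) 305–363, §4.3
[Shewchuk1997].
-/

namespace Summit.Ventures.CertifiedArithmetic.Expansions

/-! ## Signed three-term sums of cofactor terms (a `3 × 3` minor) -/

/-- **A `3 × 3` minor from three cofactor terms.**  If the true terms `C_i` and the computed ones
`Q_i` satisfy `|C_i − Q_i| ≤ a·N_i`, `|Q_i| ≤ b·N_i` (`N_i ≥ 0`), and `r = fl(Q₁ − Q₂)`,
`s = fl(r + Q₃)` carry relative errors `u` w.r.t. their true operands, then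
`|(C₁ − C₂ + C₃) − s| ≤ (a + (2u + u²)b)·N`, `|s| ≤ (1 + u)²b·N` and `|C₁ − C₂ + C₃| ≤ (a + b)·N`
with `N = N₁ + N₂ + N₃` (only `N₃ ≥ 0` is needed, `b ≥ 0` absorbing the rest). -/
theorem sum3_sub_le_of_rel {u a b C₁ C₂ C₃ Q₁ Q₂ Q₃ N₁ N₂ N₃ r s : ℚ} (hu : 0 ≤ u)
    (hb : 0 ≤ b) (hN₃ : 0 ≤ N₃)
    (e₁ : |C₁ - Q₁| ≤ a * N₁) (e₂ : |C₂ - Q₂| ≤ a * N₂) (e₃ : |C₃ - Q₃| ≤ a * N₃)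
    (q₁ : |Q₁| ≤ b * N₁) (q₂ : |Q₂| ≤ b * N₂) (q₃ : |Q₃| ≤ b * N₃)
    (hr : |(Q₁ - Q₂) - r| ≤ u * |Q₁ - Q₂|) (hs : |(r + Q₃) - s| ≤ u * |r + Q₃|) :
    |(C₁ - C₂ + C₃) - s| ≤ (a + (2 * u + u ^ 2) * b) * (N₁ + N₂ + N₃) ∧
      |s| ≤ (1 + u) ^ 2 * b * (N₁ + N₂ + N₃) ∧
      |C₁ - C₂ + C₃| ≤ (a + b) * (N₁ + N₂ + N₃) := by
  have hQ12 : |Q₁ - Q₂| ≤ b * (N₁ + N₂) := by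
    have := abs_sub Q₁ Q₂
    linarith
  have hr' : |(Q₁ - Q₂) - r| ≤ u * (b * (N₁ + N₂)) :=
    hr.trans (mul_le_mul_of_nonneg_left hQ12 hu)
  have hr_abs : |r| ≤ (1 + u) * (b * (N₁ + N₂)) := by
    have h := abs_sub_abs_le_abs_sub r (Q₁ - Q₂)
    rw [abs_sub_comm r (Q₁ - Q₂)] at h
    linarith
  have hubN₃ : 0 ≤ u * (b * N₃) := by positivity
  have hrQ : |r + Q₃| ≤ (1 + u) * (b * (N₁ + N₂ + N₃)) := by
    have h := abs_add_le r Q₃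
    linarith
  have hs' : |(r + Q₃) - s| ≤ u * ((1 + u) * (b * (N₁ + N₂ + N₃))) :=
    hs.trans (mul_le_mul_of_nonneg_left hrQ hu)
  refine ⟨?_, ?_, ?_⟩
  · have hdec : (C₁ - C₂ + C₃) - s =
        (C₁ - Q₁) - (C₂ - Q₂) + (C₃ - Q₃) + ((Q₁ - Q₂) - r) + ((r + Q₃) - s) := by ring
    rw [hdec]
    have t1 := abs_add_le ((C₁ - Q₁) - (C₂ - Q₂) + (C₃ - Q₃) + ((Q₁ - Q₂) - r)) ((r + Q₃) - s)
    have t2 := abs_add_le ((C₁ - Q₁) - (C₂ - Q₂) + (C₃ - Q₃)) ((Q₁ - Q₂) - r)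
    have t3 := abs_add_le ((C₁ - Q₁) - (C₂ - Q₂)) (C₃ - Q₃)
    have t4 := abs_sub (C₁ - Q₁) (C₂ - Q₂)
    nlinarith
  · have h := abs_sub_abs_le_abs_sub s (r + Q₃)
    rw [abs_sub_comm] at h
    nlinarith
  · have t3 := abs_add_le (C₁ - C₂) C₃
    have t4 := abs_sub C₁ C₂
    have c₁ : |C₁| ≤ (a + b) * N₁ := by
      have := abs_sub_abs_le_abs_sub C₁ Q₁
      linarith
    have c₂ : |C₂| ≤ (a + b) * N₂ := by
      have := abs_sub_abs_le_abs_sub C₂ Q₂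
      linarith
    have c₃ : |C₃| ≤ (a + b) * N₃ := by
      have := abs_sub_abs_le_abs_sub C₃ Q₃
      linarith
    linarith

/-- The same for an all-plus minor `(Q₁ ⊕ Q₂) ⊕ Q₃` (two of the four `3 × 3` minors of INSPHERE are
summed this way), by `Q₁ + Q₂ = Q₁ − (−Q₂)`. -/
theorem sum3add_sub_le_of_rel {u a b C₁ C₂ C₃ Q₁ Q₂ Q₃ N₁ N₂ N₃ r s : ℚ} (hu : 0 ≤ u)
    (hb : 0 ≤ b) (hN₃ : 0 ≤ N₃)
    (e₁ : |C₁ - Q₁| ≤ a * N₁) (e₂ : |C₂ - Q₂| ≤ a * N₂) (e₃ : |C₃ - Q₃| ≤ a * N₃)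
    (q₁ : |Q₁| ≤ b * N₁) (q₂ : |Q₂| ≤ b * N₂) (q₃ : |Q₃| ≤ b * N₃)
    (hr : |(Q₁ + Q₂) - r| ≤ u * |Q₁ + Q₂|) (hs : |(r + Q₃) - s| ≤ u * |r + Q₃|) :
    |(C₁ + C₂ + C₃) - s| ≤ (a + (2 * u + u ^ 2) * b) * (N₁ + N₂ + N₃) ∧
      |s| ≤ (1 + u) ^ 2 * b * (N₁ + N₂ + N₃) ∧
      |C₁ + C₂ + C₃| ≤ (a + b) * (N₁ + N₂ + N₃) := by
  have e₂' : |(-C₂) - (-Q₂)| ≤ a * N₂ := by rwa [neg_sub_neg, abs_sub_comm]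
  have q₂' : |(-Q₂)| ≤ b * N₂ := by rwa [abs_neg]
  have hr' : |(Q₁ - -Q₂) - r| ≤ u * |Q₁ - -Q₂| := by rwa [sub_neg_eq_add]
  have h := sum3_sub_le_of_rel hu hb hN₃ e₁ e₂' e₃ q₁ q₂' q₃ hr' hs
  simpa only [sub_neg_eq_add] using h

/-! ## The three-dimensional lift -/

/-- A rounding with relative error `u < 1` w.r.t. the COMPUTED value does not change the sign of
a nonnegative quantity: `x ≥ 0`, `|x − y| ≤ u|y|` give `y ≥ 0`. -/
theorem nonneg_of_abs_sub_le_mul_abs {u x y : ℚ} (hx : 0 ≤ x) (hu : u < 1)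
    (h : |x - y| ≤ u * |y|) : 0 ≤ y := by
  by_contra hy
  have hy' : y < 0 := lt_of_not_ge hy
  rw [abs_of_neg hy'] at h
  have h1 := (abs_sub_le_iff.mp h).1
  nlinarith [mul_pos (sub_pos.mpr hu) (neg_pos.mpr hy')]

/-- **The lift `(x ⊗ x ⊕ y ⊗ y) ⊕ z ⊗ z`.**  With `t_i = x_i ± u|x_i|` (true vs computed
differences), squares `x_i·x_i = S_i ± u·|S_i|`, `S₁ + S₂ = R ± u|R|`, `R + S₃ = L ± u|L|` (errors
w.r.t. the computed values, `0 ≤ u < 1`), the computed lift `L` is nonnegative and the true lift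
satisfies `|(t₁² + t₂² + t₃²) − L| ≤ ((1 + u)⁵ − 1)·L`. -/
theorem lift3_sub_le_of_rel {u t₁ t₂ t₃ x₁ x₂ x₃ S₁ S₂ S₃ R L : ℚ} (hu : 0 ≤ u) (hu1 : u < 1)
    (h₁ : |t₁ - x₁| ≤ u * |x₁|) (h₂ : |t₂ - x₂| ≤ u * |x₂|) (h₃ : |t₃ - x₃| ≤ u * |x₃|)
    (hS₁ : |x₁ * x₁ - S₁| ≤ u * |S₁|) (hS₂ : |x₂ * x₂ - S₂| ≤ u * |S₂|)
    (hS₃ : |x₃ * x₃ - S₃| ≤ u * |S₃|) (hR : |(S₁ + S₂) - R| ≤ u * |R|)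
    (hL : |(R + S₃) - L| ≤ u * |L|) :
    |(t₁ * t₁ + t₂ * t₂ + t₃ * t₃) - L| ≤
      (5 * u + 10 * u ^ 2 + 10 * u ^ 3 + 5 * u ^ 4 + u ^ 5) * L ∧ 0 ≤ L := by
  have hS₁0 := nonneg_of_abs_sub_le_mul_abs (mul_self_nonneg x₁) hu1 hS₁
  have hS₂0 := nonneg_of_abs_sub_le_mul_abs (mul_self_nonneg x₂) hu1 hS₂
  have hS₃0 := nonneg_of_abs_sub_le_mul_abs (mul_self_nonneg x₃) hu1 hS₃
  have hR0 := nonneg_of_abs_sub_le_mul_abs (add_nonneg hS₁0 hS₂0) hu1 hR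
  have hL0 := nonneg_of_abs_sub_le_mul_abs (add_nonneg hR0 hS₃0) hu1 hL
  refine ⟨?_, hL0⟩
  have e₁ := Literature.ComputerArithmetic.Shewchuk1997.abs_mul_sub_le_of_rel hu h₁ h₁ hS₁
  have e₂ := Literature.ComputerArithmetic.Shewchuk1997.abs_mul_sub_le_of_rel hu h₂ h₂ hS₂
  have e₃ := Literature.ComputerArithmetic.Shewchuk1997.abs_mul_sub_le_of_rel hu h₃ h₃ hS₃
  rw [abs_of_nonneg hS₁0] at e₁
  rw [abs_of_nonneg hS₂0] at e₂
  rw [abs_of_nonneg hS₃0] at e₃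
  rw [abs_of_nonneg hR0] at hR
  rw [abs_of_nonneg hL0] at hL
  have hc : 0 ≤ 3 * u + 3 * u ^ 2 + u ^ 3 := by positivity
  have hsum1 : S₁ + S₂ ≤ (1 + u) * R := by
    have h := (abs_sub_le_iff.mp hR).1
    linarith
  have hsum2 : R + S₃ ≤ (1 + u) * L := by
    have h := (abs_sub_le_iff.mp hL).1
    linarith
  have m1 : (3 * u + 3 * u ^ 2 + u ^ 3) * (S₁ + S₂) ≤ (3 * u + 3 * u ^ 2 + u ^ 3) * ((1 + u) * R) :=
    mul_le_mul_of_nonneg_left hsum1 hc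
  have m2 : ((3 * u + 3 * u ^ 2 + u ^ 3) * (1 + u) + u) * (R + S₃) ≤
      ((3 * u + 3 * u ^ 2 + u ^ 3) * (1 + u) + u) * ((1 + u) * L) :=
    mul_le_mul_of_nonneg_left hsum2 (by positivity)
  have m3 : 0 ≤ (3 * u + 3 * u ^ 2 + u ^ 3) * u * S₃ := by positivity
  have hdec : (t₁ * t₁ + t₂ * t₂ + t₃ * t₃) - L =
      (t₁ * t₁ - S₁) + (t₂ * t₂ - S₂) + (t₃ * t₃ - S₃) + ((S₁ + S₂) - R) + ((R + S₃) - L) := by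
    ring
  rw [hdec]
  have a1 := abs_add_le ((t₁ * t₁ - S₁) + (t₂ * t₂ - S₂) + (t₃ * t₃ - S₃) + ((S₁ + S₂) - R))
    ((R + S₃) - L)
  have a2 := abs_add_le ((t₁ * t₁ - S₁) + (t₂ * t₂ - S₂) + (t₃ * t₃ - S₃)) ((S₁ + S₂) - R)
  have a3 := abs_add_three (t₁ * t₁ - S₁) (t₂ * t₂ - S₂) (t₃ * t₃ - S₃)
  nlinarith

/-! ## A lifted term and the four-term determinant -/

/-- **A lifted term `lift ⊗ minor`.**  From `|Λ − ℓ| ≤ v·ℓ` (true vs computed lift, `ℓ ≥ 0`),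
`|S − s| ≤ a·N`, `|s| ≤ b·N`, `|S| ≤ c·N` (true vs computed minor over a majorant `N`) and
`q = fl(ℓ·s)` with relative error `u` w.r.t. `ℓ·s`:
`|Λ·S − q| ≤ (vc + a + ub)·(ℓN)` and `|q| ≤ (1 + u)b·(ℓN)`. -/
theorem liftedTerm_sub_le_of_rel {u v a b c Λ ℓ S s N q : ℚ} (hu : 0 ≤ u) (hv : 0 ≤ v)
    (hℓ : 0 ≤ ℓ) (hΛ : |Λ - ℓ| ≤ v * ℓ) (e : |S - s| ≤ a * N)
    (hsb : |s| ≤ b * N) (hSc : |S| ≤ c * N) (hq : |ℓ * s - q| ≤ u * |ℓ * s|) :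
    |Λ * S - q| ≤ (v * c + a + u * b) * (ℓ * N) ∧ |q| ≤ (1 + u) * b * (ℓ * N) := by
  have h1 : |(Λ - ℓ) * S| ≤ v * ℓ * (c * N) := by
    rw [abs_mul]
    exact mul_le_mul hΛ hSc (abs_nonneg _) (by positivity)
  have h2 : |ℓ * (S - s)| ≤ ℓ * (a * N) := by
    rw [abs_mul, abs_of_nonneg hℓ]
    exact mul_le_mul_of_nonneg_left e hℓ
  have h3 : |ℓ * s| ≤ ℓ * (b * N) := by
    rw [abs_mul, abs_of_nonneg hℓ]
    exact mul_le_mul_of_nonneg_left hsb hℓ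
  have hq' : |ℓ * s - q| ≤ u * (ℓ * (b * N)) := hq.trans (mul_le_mul_of_nonneg_left h3 hu)
  constructor
  · have hdec : Λ * S - q = (Λ - ℓ) * S + ℓ * (S - s) + (ℓ * s - q) := by ring
    rw [hdec]
    have t := abs_add_three ((Λ - ℓ) * S) (ℓ * (S - s)) (ℓ * s - q)
    nlinarith
  · have h := abs_sub_abs_le_abs_sub q (ℓ * s)
    rw [abs_sub_comm] at h
    nlinarith

/-- **The determinant `(q_d ⊖ q_c) ⊕ (q_b ⊖ q_a)`.**  From per-term errors `|T_x − q_x| ≤ a·M_x`,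
sizes `|q_x| ≤ b·M_x`, the two subtractions with relative error `u` w.r.t. their true
operands and the last addition with relative error `u` w.r.t. the COMPUTED `det`:
`|((T_d − T_c) + (T_b − T_a)) − det| ≤ u|det| + (a + ub)·(M_a + M_b + M_c + M_d)`. -/
theorem det4_sub_le_of_rel {u a b Ta Tb Tc Td qa qb qc qd Ma Mb Mc Md r₁ r₂ det : ℚ}
    (hu : 0 ≤ u) (ea : |Ta - qa| ≤ a * Ma) (eb : |Tb - qb| ≤ a * Mb) (ec : |Tc - qc| ≤ a * Mc)
    (ed : |Td - qd| ≤ a * Md) (ba : |qa| ≤ b * Ma) (bb : |qb| ≤ b * Mb) (bc : |qc| ≤ b * Mc)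
    (bd : |qd| ≤ b * Md) (hr₁ : |(qd - qc) - r₁| ≤ u * |qd - qc|)
    (hr₂ : |(qb - qa) - r₂| ≤ u * |qb - qa|) (hdet : |(r₁ + r₂) - det| ≤ u * |det|) :
    |((Td - Tc) + (Tb - Ta)) - det| ≤ u * |det| + (a + u * b) * (Ma + Mb + Mc + Md) := by
  have h1 : |(qd - qc) - r₁| ≤ u * (b * (Md + Mc)) := by
    refine hr₁.trans (mul_le_mul_of_nonneg_left ?_ hu)
    have := abs_sub qd qc
    linarith
  have h2 : |(qb - qa) - r₂| ≤ u * (b * (Mb + Ma)) := by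
    refine hr₂.trans (mul_le_mul_of_nonneg_left ?_ hu)
    have := abs_sub qb qa
    linarith
  have hdec : ((Td - Tc) + (Tb - Ta)) - det = (Td - qd) - (Tc - qc) + ((Tb - qb) - (Ta - qa))
      + ((qd - qc) - r₁) + ((qb - qa) - r₂) + ((r₁ + r₂) - det) := by ring
  rw [hdec]
  have t1 := abs_add_le ((Td - qd) - (Tc - qc) + ((Tb - qb) - (Ta - qa)) + ((qd - qc) - r₁)
    + ((qb - qa) - r₂)) ((r₁ + r₂) - det)
  have t2 := abs_add_le ((Td - qd) - (Tc - qc) + ((Tb - qb) - (Ta - qa)) + ((qd - qc) - r₁))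
    ((qb - qa) - r₂)
  have t3 := abs_add_le ((Td - qd) - (Tc - qc) + ((Tb - qb) - (Ta - qa))) ((qd - qc) - r₁)
  have t4 := abs_add_le ((Td - qd) - (Tc - qc)) ((Tb - qb) - (Ta - qa))
  have t5 := abs_sub (Td - qd) (Tc - qc)
  have t6 := abs_sub (Tb - qb) (Ta - qa)
  nlinarith

/-! ## The permanent is not underestimated by more than `(1 − u)⁹` -/

/-- `x ≥ 0` and `|x − y| ≤ u|x|` give `y ≥ (1 − u)x`. -/
theorem ge_of_abs_sub_le {u x y : ℚ} (hx : 0 ≤ x) (h : |x - y| ≤ u * |x|) : (1 - u) * x ≤ y := by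
  rw [abs_of_nonneg hx] at h
  have := (abs_sub_le_iff.mp h).1
  linarith

/-- **One `3 × 3` block of the permanent**, `((A₁ ⊗ w₁) ⊕ (A₂ ⊗ w₂)) ⊕ (A₃ ⊗ w₃)` with
`A_i = fl(S_i)`, `S_i = |P_i| + |P_i'| ≥ 0`, `w_i = |z_i| ≥ 0`, every operation with relative error
`u ≤ 1` w.r.t. its true (nonnegative) operand: the result is at least `(1 − u)⁴·Σ w_i·S_i`. -/
theorem perm3_lower {u w₁ w₂ w₃ S₁ S₂ S₃ A₁ A₂ A₃ B₁ B₂ B₃ V T : ℚ} (hu0 : 0 ≤ u) (hu1 : u ≤ 1)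
    (hw₁ : 0 ≤ w₁) (hw₂ : 0 ≤ w₂) (hw₃ : 0 ≤ w₃) (hS₁ : 0 ≤ S₁) (hS₂ : 0 ≤ S₂) (hS₃ : 0 ≤ S₃)
    (hA₁ : |S₁ - A₁| ≤ u * |S₁|) (hA₂ : |S₂ - A₂| ≤ u * |S₂|) (hA₃ : |S₃ - A₃| ≤ u * |S₃|)
    (hB₁ : |A₁ * w₁ - B₁| ≤ u * |A₁ * w₁|) (hB₂ : |A₂ * w₂ - B₂| ≤ u * |A₂ * w₂|)
    (hB₃ : |A₃ * w₃ - B₃| ≤ u * |A₃ * w₃|) (hV : |(B₁ + B₂) - V| ≤ u * |B₁ + B₂|)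
    (hT : |(V + B₃) - T| ≤ u * |V + B₃|) :
    (1 - u) ^ 4 * (w₁ * S₁ + w₂ * S₂ + w₃ * S₃) ≤ T := by
  have h1u : 0 ≤ 1 - u := by linarith
  have h1u1 : 1 - u ≤ 1 := by linarith
  have a₁ := ge_of_abs_sub_le hS₁ hA₁
  have a₂ := ge_of_abs_sub_le hS₂ hA₂
  have a₃ := ge_of_abs_sub_le hS₃ hA₃
  have hA₁0 : 0 ≤ A₁ := le_trans (mul_nonneg h1u hS₁) a₁
  have hA₂0 : 0 ≤ A₂ := le_trans (mul_nonneg h1u hS₂) a₂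
  have hA₃0 : 0 ≤ A₃ := le_trans (mul_nonneg h1u hS₃) a₃
  have b₁ : (1 - u) ^ 2 * (w₁ * S₁) ≤ B₁ :=
    calc (1 - u) ^ 2 * (w₁ * S₁) = (1 - u) * ((1 - u) * S₁ * w₁) := by ring
      _ ≤ (1 - u) * (A₁ * w₁) := mul_le_mul_of_nonneg_left (mul_le_mul_of_nonneg_right a₁ hw₁) h1u
      _ ≤ B₁ := ge_of_abs_sub_le (mul_nonneg hA₁0 hw₁) hB₁
  have b₂ : (1 - u) ^ 2 * (w₂ * S₂) ≤ B₂ :=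
    calc (1 - u) ^ 2 * (w₂ * S₂) = (1 - u) * ((1 - u) * S₂ * w₂) := by ring
      _ ≤ (1 - u) * (A₂ * w₂) := mul_le_mul_of_nonneg_left (mul_le_mul_of_nonneg_right a₂ hw₂) h1u
      _ ≤ B₂ := ge_of_abs_sub_le (mul_nonneg hA₂0 hw₂) hB₂
  have b₃ : (1 - u) ^ 2 * (w₃ * S₃) ≤ B₃ :=
    calc (1 - u) ^ 2 * (w₃ * S₃) = (1 - u) * ((1 - u) * S₃ * w₃) := by ring
      _ ≤ (1 - u) * (A₃ * w₃) := mul_le_mul_of_nonneg_left (mul_le_mul_of_nonneg_right a₃ hw₃) h1u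
      _ ≤ B₃ := ge_of_abs_sub_le (mul_nonneg hA₃0 hw₃) hB₃
  have hB₁0 : 0 ≤ B₁ := le_trans (by positivity) b₁
  have hB₂0 : 0 ≤ B₂ := le_trans (by positivity) b₂
  have hB₃0 : 0 ≤ B₃ := le_trans (by positivity) b₃
  have v := ge_of_abs_sub_le (add_nonneg hB₁0 hB₂0) hV
  have hV0 : 0 ≤ V := le_trans (by positivity) v
  have t := ge_of_abs_sub_le (add_nonneg hV0 hB₃0) hT
  have hlow : (1 - u) ^ 4 * (w₃ * S₃) ≤ (1 - u) ^ 3 * (w₃ * S₃) :=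
    mul_le_mul_of_nonneg_right (pow_le_pow_of_le_one h1u h1u1 (by norm_num)) (by positivity)
  calc (1 - u) ^ 4 * (w₁ * S₁ + w₂ * S₂ + w₃ * S₃)
      ≤ (1 - u) ^ 4 * (w₁ * S₁ + w₂ * S₂) + (1 - u) ^ 3 * (w₃ * S₃) := by linarith
    _ = (1 - u) * ((1 - u) * ((1 - u) ^ 2 * (w₁ * S₁) + (1 - u) ^ 2 * (w₂ * S₂))
          + (1 - u) ^ 2 * (w₃ * S₃)) := by ring
    _ ≤ (1 - u) * ((1 - u) * (B₁ + B₂) + B₃) := by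
        apply mul_le_mul_of_nonneg_left _ h1u
        have := mul_le_mul_of_nonneg_left (add_le_add b₁ b₂) h1u
        linarith
    _ ≤ (1 - u) * (V + B₃) := mul_le_mul_of_nonneg_left (by linarith) h1u
    _ ≤ T := t

/-- **The permanent and the error bound**, `W = ((G_a ⊕ G_b) ⊕ G_c) ⊕ G_d` with
`G_x = fl(T_x·ℓ_x)`, `T_x ≥ (1 − u)⁴N_x` (the blocks, `perm3_lower`), `ℓ_x ≥ 0` the computed lifts,
and `E = fl(K·W)`, every operation with relative error `u ≤ 1` w.r.t. its true operand:
`E ≥ (1 − u)⁹·K·Π` with `Π = Σ ℓ_x·N_x`. -/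
theorem perm4_lower {u K Na Nb Nc Nd Ta Tb Tc Td la lb lc ld Ga Gb Gc Gd U₁ U₂ W E : ℚ}
    (hu0 : 0 ≤ u) (hu1 : u ≤ 1) (hK : 0 ≤ K) (hNa : 0 ≤ Na) (hNb : 0 ≤ Nb) (hNc : 0 ≤ Nc)
    (hNd : 0 ≤ Nd) (hla : 0 ≤ la) (hlb : 0 ≤ lb) (hlc : 0 ≤ lc) (hld : 0 ≤ ld)
    (hTa : (1 - u) ^ 4 * Na ≤ Ta) (hTb : (1 - u) ^ 4 * Nb ≤ Tb) (hTc : (1 - u) ^ 4 * Nc ≤ Tc)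
    (hTd : (1 - u) ^ 4 * Nd ≤ Td) (hGa : |Ta * la - Ga| ≤ u * |Ta * la|)
    (hGb : |Tb * lb - Gb| ≤ u * |Tb * lb|) (hGc : |Tc * lc - Gc| ≤ u * |Tc * lc|)
    (hGd : |Td * ld - Gd| ≤ u * |Td * ld|) (hU₁ : |(Ga + Gb) - U₁| ≤ u * |Ga + Gb|)
    (hU₂ : |(U₁ + Gc) - U₂| ≤ u * |U₁ + Gc|) (hW : |(U₂ + Gd) - W| ≤ u * |U₂ + Gd|)
    (hE : |K * W - E| ≤ u * |K * W|) :
    (1 - u) ^ 9 * K * (la * Na + lb * Nb + lc * Nc + ld * Nd) ≤ E := by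
  have h1u : 0 ≤ 1 - u := by linarith
  have h1u1 : 1 - u ≤ 1 := by linarith
  have hTa0 : 0 ≤ Ta := le_trans (by positivity) hTa
  have hTb0 : 0 ≤ Tb := le_trans (by positivity) hTb
  have hTc0 : 0 ≤ Tc := le_trans (by positivity) hTc
  have hTd0 : 0 ≤ Td := le_trans (by positivity) hTd
  have ga := ge_of_abs_sub_le (mul_nonneg hTa0 hla) hGa
  have gb := ge_of_abs_sub_le (mul_nonneg hTb0 hlb) hGb
  have gc := ge_of_abs_sub_le (mul_nonneg hTc0 hlc) hGc
  have gd := ge_of_abs_sub_le (mul_nonneg hTd0 hld) hGd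
  have ga' : (1 - u) * ((1 - u) ^ 4 * Na * la) ≤ Ga :=
    le_trans (mul_le_mul_of_nonneg_left (mul_le_mul_of_nonneg_right hTa hla) h1u) ga
  have gb' : (1 - u) * ((1 - u) ^ 4 * Nb * lb) ≤ Gb :=
    le_trans (mul_le_mul_of_nonneg_left (mul_le_mul_of_nonneg_right hTb hlb) h1u) gb
  have gc' : (1 - u) * ((1 - u) ^ 4 * Nc * lc) ≤ Gc :=
    le_trans (mul_le_mul_of_nonneg_left (mul_le_mul_of_nonneg_right hTc hlc) h1u) gc
  have gd' : (1 - u) * ((1 - u) ^ 4 * Nd * ld) ≤ Gd :=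
    le_trans (mul_le_mul_of_nonneg_left (mul_le_mul_of_nonneg_right hTd hld) h1u) gd
  have hGa0 : 0 ≤ Ga := le_trans (by positivity) ga'
  have hGb0 : 0 ≤ Gb := le_trans (by positivity) gb'
  have hGc0 : 0 ≤ Gc := le_trans (by positivity) gc'
  have hGd0 : 0 ≤ Gd := le_trans (by positivity) gd'
  have u₁ := ge_of_abs_sub_le (add_nonneg hGa0 hGb0) hU₁
  have hU₁0 : 0 ≤ U₁ := le_trans (by positivity) u₁
  have u₂ := ge_of_abs_sub_le (add_nonneg hU₁0 hGc0) hU₂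
  have hU₂0 : 0 ≤ U₂ := le_trans (by positivity) u₂
  have w := ge_of_abs_sub_le (add_nonneg hU₂0 hGd0) hW
  have hW0 : 0 ≤ W := le_trans (by positivity) w
  have e := ge_of_abs_sub_le (mul_nonneg hK hW0) hE
  -- lower the shallower terms to the common depth `(1 − u)⁸`
  have d₁ : (1 - u) ^ 8 * (lc * Nc) ≤ (1 - u) ^ 7 * (lc * Nc) :=
    mul_le_mul_of_nonneg_right (pow_le_pow_of_le_one h1u h1u1 (by norm_num)) (by positivity)
  have d₂ : (1 - u) ^ 8 * (ld * Nd) ≤ (1 - u) ^ 6 * (ld * Nd) :=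
    mul_le_mul_of_nonneg_right (pow_le_pow_of_le_one h1u h1u1 (by norm_num)) (by positivity)
  have hW' : (1 - u) ^ 8 * (la * Na + lb * Nb + lc * Nc + ld * Nd) ≤ W :=
    calc (1 - u) ^ 8 * (la * Na + lb * Nb + lc * Nc + ld * Nd)
        ≤ (1 - u) ^ 8 * (la * Na + lb * Nb) + (1 - u) ^ 7 * (lc * Nc)
            + (1 - u) ^ 6 * (ld * Nd) := by
          linarith
      _ = (1 - u) * ((1 - u) * ((1 - u) * ((1 - u) * ((1 - u) ^ 4 * Na * la)
            + (1 - u) * ((1 - u) ^ 4 * Nb * lb)) + (1 - u) * ((1 - u) ^ 4 * Nc * lc))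
            + (1 - u) * ((1 - u) ^ 4 * Nd * ld)) := by ring
      _ ≤ (1 - u) * ((1 - u) * ((1 - u) * (Ga + Gb) + Gc) + Gd) := by
          apply mul_le_mul_of_nonneg_left _ h1u
          apply add_le_add _ gd'
          apply mul_le_mul_of_nonneg_left _ h1u
          apply add_le_add _ gc'
          exact mul_le_mul_of_nonneg_left (add_le_add ga' gb') h1u
      _ ≤ (1 - u) * ((1 - u) * (U₁ + Gc) + Gd) := by
          apply mul_le_mul_of_nonneg_left _ h1u
          have := mul_le_mul_of_nonneg_left (add_le_add_right u₁ Gc) h1u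
          linarith
      _ ≤ (1 - u) * (U₂ + Gd) := mul_le_mul_of_nonneg_left (by linarith) h1u
      _ ≤ W := w
  calc (1 - u) ^ 9 * K * (la * Na + lb * Nb + lc * Nc + ld * Nd)
      = (1 - u) * (K * ((1 - u) ^ 8 * (la * Na + lb * Nb + lc * Nc + ld * Nd))) := by ring
    _ ≤ (1 - u) * (K * W) := mul_le_mul_of_nonneg_left (mul_le_mul_of_nonneg_left hW' hK) h1u
    _ ≤ E := e

end Summit.Ventures.CertifiedArithmetic.Expansions
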